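import Literature.Probability.RandomPlanarGeometry.BDGS2012GrahamLemma4
import Literature.Probability.LatticeModels.SRWReturnCounts
import HarnessLib

/-!
# Graham's Borel-type bound for `z_c(d)` (BDGS 2012, (1.20)), IV: the simple-random-walk inputs
# of Lemma 7 — the maximum principle at odd times and the factorial bound on return counts

Sibling file of `Literature.Probability.RandomPlanarGeometry.BDGS2012` (fact
`BDGS2012_Graham_criticalPoint_bound` = Graham 2010, Theorem 1), sequel to
`BDGS2012GrahamLemma4.lean`. Graham's diagrammatic length bound (Lemma 7) rests on two facts
about the number `c_k^{(0)}(x)` of `k`-step nearest-neighbour walks `0 → x` of `ℤ^d` (here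
`SRW.count d k x`, `Literature/Probability/LatticeModels/SRWStepSequences.lean`):

* "When `k` is even, `c_k^{(0)}(x)` is maximized by `x = 0`" — in the tree
  (`SRW.count_add_self_le`, `SRWReturnCounts.lean`) — and "When `k` is odd, `c_k^{(0)}(x)` is
  maximized by `x = e₁ = (1,0,…,0)` and `c_{2m-1}^{(0)}(e₁) = c_{2m}^{(0)}(0)/(2d)`" (Graham 2010,
  §5, proof of Lemma 7, stated without proof). The tree's odd-time form
  `SRW.count_one_add_add_self_le` (`c_{2m+1}(x) ≤ 2d·c_{2m}(0)`) is weaker by a factor of order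
  `d` than the sharp statement, and the sharp statement is what makes an odd piece of length
  `2m-1` cost `m! C^m s^m` rather than `m! C^m s^{m-1}` (`s = 1/(2d)`); it is PROVED here by an
  induction on the number of steps: coordinatewise unimodality `c_n(x + 2eᵢ) ≤ c_n(x)` for
  `xᵢ ≥ 0` (`count_add_two_single_le`) and pair removal `c_n(x + e_a + e_b) ≤ c_n(x)` for
  `x_a = x_b = 0` (`count_add_single_add_single_le`), whence `c_n(x) ≤ c_n(e_a)` for odd `n`
  (`count_le_count_single`) and `2d·c_n(e_a) = c_{n+1}(0)` (`two_mul_card_mul_count_single`).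
* "The number of simple walks from `0` to `0` in `ℤ^d` of length `2m` is less than the number of
  `2m` step walks that are restricted to an `m` dimensional subspace [Hammersley]:
  `c_{2m}^{(0)}(0) ≤ C(d,m)(2m)^{2m} ≤ (d^m/m!)(2m)^{2m}` … By Stirling's formula,
  `(2m) c_{2m}^{(0)}(0) ≤ C₄^m s^{-m} m!`" (ibid.): PROVED as `count_two_mul_zero_le`
  (`c_{2m}(0) ≤ (m+1)·36^m·m!·d^m` for `1 ≤ m ≤ d`) from the dimension decomposition of
  `BDGS2012GrahamDimension.lean` (a closed walk uses each of its coordinates at least twice, so at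
  most `m` of them).

## What is formalised (namespace `Literature.Probability.RandomPlanarGeometry.SAW.Zd.Graham2010`)

`reflectCoord`, `count_reflectCoord` (invariance of `c_n` under `xᵢ ↦ -xᵢ`), `count_relabel_equiv`
(invariance under permutations of the coordinates), `count_add_two_single_le`,
`count_add_single_add_single_le`, `count_le_count_single` (odd maximum principle),
`two_mul_card_mul_count_single`, `count_two_mul_zero_le`; all for Mathlib/tree objects only
(`SRW.count`, `Pi.single`), no new notions. Everything is folklore and fully proved.
-/

noncomputable section

open Finset
open Literature.Probability.LatticeModels Literature.Probability.LatticeModels.SRW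
open scoped BigOperators

namespace Literature.Probability.RandomPlanarGeometry.SAW.Zd.Graham2010

variable {d : ℕ}

/-! ### Reflection of one coordinate -/

/-- Reflect the `i`-th coordinate: `(reflectCoord i x)_i = -x_i`, other coordinates unchanged.
[folklore] -/
def reflectCoord (i : Fin d) (x : Site d) : Site d :=
  fun j => if j = i then -x j else x j

/-- `reflectCoord i` is an involution. [folklore] -/
theorem reflectCoord_reflectCoord (i : Fin d) (x : Site d) : reflectCoord i (reflectCoord i x) = x := by
  funext j
  by_cases hj : j = i <;> simp [reflectCoord, hj]

/-- `reflectCoord i` is additive. [folklore] -/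
theorem reflectCoord_sub (i : Fin d) (x y : Site d) :
    reflectCoord i (x - y) = reflectCoord i x - reflectCoord i y := by
  funext j
  by_cases hj : j = i <;> simp [reflectCoord, hj]; ring

/-- The reflected direction: flip the sign of the steps in coordinate `i`. [folklore] -/
def reflectDir (i : Fin d) (v : Dir d) : Dir d :=
  if v.1 = i then v.neg else v

/-- `reflectDir i` is an involution. [folklore] -/
theorem reflectDir_reflectDir (i : Fin d) (v : Dir d) : reflectDir i (reflectDir i v) = v := by
  unfold reflectDir
  by_cases h : v.1 = i
  · rw [if_pos h, if_pos (by simpa [Dir.neg] using h)]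
    simp [Dir.neg]
  · rw [if_neg h, if_neg h]

/-- A unit step is `± e_{v.1}`: `stepVec v = Pi.single v.1 (±1)`. [folklore] -/
theorem stepVec_eq_single (v : Dir d) : stepVec v = Pi.single v.1 (if v.2 then (1 : ℤ) else -1) := by
  unfold stepVec
  cases v.2 <;> simp [Pi.single_neg]

/-- `reflectCoord i (e_v) = e_{reflectDir i v}`. [folklore] -/
theorem reflectCoord_stepVec (i : Fin d) (v : Dir d) :
    reflectCoord i (stepVec v) = stepVec (reflectDir i v) := by
  rcases v with ⟨k, b⟩
  funext j
  unfold reflectDir reflectCoord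
  by_cases hk : k = i
  · subst hk
    have hk' : ((k, b) : Dir d).1 = k := rfl
    rw [if_pos hk']
    simp only [Dir.neg, stepVec_eq_single]
    by_cases hj : j = k
    · subst hj
      cases b <;> simp
    · rw [if_neg hj, Pi.single_eq_of_ne hj, Pi.single_eq_of_ne hj]
  · have hk' : ¬ ((k, b) : Dir d).1 = i := hk
    rw [if_neg hk']
    simp only [stepVec_eq_single]
    by_cases hj : j = i
    · subst hj
      rw [if_pos rfl, Pi.single_eq_of_ne (Ne.symm hk)]
      simp
    · rw [if_neg hj]

/-- **Reflection symmetry** `c_n(reflectCoord i x) = c_n(x)` (induction on `n` through the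
first-step decomposition). [folklore] -/
theorem count_reflectCoord (i : Fin d) (n : ℕ) (x : Site d) :
    SRW.count d n (reflectCoord i x) = SRW.count d n x := by
  induction n generalizing x with
  | zero =>
    rw [SRW.count_zero, SRW.count_zero]
    have : reflectCoord i x = 0 ↔ x = 0 := by
      constructor
      · intro h
        have := congrArg (reflectCoord i) h
        rw [reflectCoord_reflectCoord] at this
        rw [this]; funext j; simp [reflectCoord]
      · intro h; rw [h]; funext j; simp [reflectCoord]
    simp only [this]
  | succ n ih =>
    rw [show n + 1 = 1 + n from Nat.add_comm n 1, SRW.count_one_add, SRW.count_one_add]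
    -- reindex the sum by the involution `reflectDir i`
    refine Fintype.sum_bijective (reflectDir i)
      (Function.Involutive.bijective (reflectDir_reflectDir i)) _ _ fun v => ?_
    rw [← ih (x - stepVec (reflectDir i v)), reflectCoord_sub, reflectCoord_stepVec,
      reflectDir_reflectDir]

/-- If `x_i = 0` then `c_n(x + e) = c_n(x - e)` for `e = ±eᵢ` (reflection). [folklore] -/
theorem count_add_eq_count_sub_of_apply_eq_zero {i : Fin d} {x : Site d} (hx : x i = 0) (n : ℕ)
    (c : ℤ) : SRW.count d n (x + Pi.single i c) = SRW.count d n (x - Pi.single i c) := by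
  have : reflectCoord i (x + Pi.single i c) = x - Pi.single i c := by
    funext j
    by_cases hj : j = i
    · subst hj; simp [reflectCoord, hx]
    · simp [reflectCoord, hj]
  rw [← this, count_reflectCoord]

/-! ### Coordinatewise unimodality and pair removal -/

/-- **Coordinatewise unimodality**: `c_n(x + 2eᵢ) ≤ c_n(x)` whenever `xᵢ ≥ 0` (the `i`-th
coordinate of the `n`-step law is unimodal about `0`). [folklore] -/
theorem count_add_two_single_le (i : Fin d) (n : ℕ) :
    ∀ x : Site d, 0 ≤ x i → SRW.count d n (x + Pi.single i 2) ≤ SRW.count d n x := by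
  induction n with
  | zero =>
    intro x hx
    rw [SRW.count_zero, SRW.count_zero]
    split_ifs with h1 h2
    · exact le_rfl
    · exfalso
      have := congrFun h1 i
      simp at this
      omega
    · exact Nat.zero_le _
    · exact le_rfl
  | succ n ih =>
    intro x hx
    rw [show n + 1 = 1 + n from Nat.add_comm n 1, SRW.count_one_add, SRW.count_one_add]
    refine Finset.sum_le_sum fun v _ => ?_
    by_cases hv : v.1 = i
    · -- steps `± eᵢ`
      rw [stepVec_eq_single, hv]
      cases v.2
      · -- `-eᵢ`: `x + 2eᵢ + eᵢ = (x + eᵢ) + 2eᵢ`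
        simp only [Bool.false_eq_true, ↓reduceIte]
        have h1 : x + Pi.single i 2 - Pi.single i (-1 : ℤ) = (x - Pi.single i (-1 : ℤ)) + Pi.single i 2 := by
          abel
        rw [h1]
        refine ih _ ?_
        simp only [Pi.sub_apply, Pi.single_eq_same]
        omega
      · simp only [↓reduceIte]
        rcases hx.lt_or_eq with hpos | hzero
        · -- `xᵢ ≥ 1`: `x + 2eᵢ - eᵢ = (x - eᵢ) + 2eᵢ`, `(x - eᵢ)ᵢ ≥ 0`
          have h1 : x + Pi.single i 2 - Pi.single i (1 : ℤ) = (x - Pi.single i (1 : ℤ)) + Pi.single i 2 := by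
            abel
          rw [h1]
          refine ih _ ?_
          simp only [Pi.sub_apply, Pi.single_eq_same]
          omega
        · -- `xᵢ = 0`: `c_n(x + eᵢ) = c_n(x - eᵢ)` by reflection
          have h1 : x + Pi.single i 2 - Pi.single i (1 : ℤ) = x + Pi.single i (1 : ℤ) := by
            rw [add_sub_assoc, ← Pi.single_sub]
            norm_num
          rw [h1, count_add_eq_count_sub_of_apply_eq_zero hzero.symm]
    · -- steps in another coordinate: induction hypothesis at `x - e_v`
      have h1 : x + Pi.single i 2 - stepVec v = (x - stepVec v) + Pi.single i 2 := by abel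
      rw [h1]
      refine ih _ ?_
      rw [stepVec_eq_single]
      simp [Pi.single_eq_of_ne (Ne.symm hv), hx]

/-- The four directions in two distinct coordinates `a ≠ b`. [folklore] -/
theorem filter_fst_eq_or (a b : Fin d) (hab : a ≠ b) :
    (Finset.univ.filter fun v : Dir d => v.1 = a ∨ v.1 = b) =
      {(a, true), (a, false), (b, true), (b, false)} := by
  ext ⟨j, c⟩
  simp only [Finset.mem_filter, Finset.mem_univ, true_and, Finset.mem_insert, Finset.mem_singleton,
    Prod.mk.injEq]
  constructor
  · rintro (rfl | rfl) <;> cases c <;> simp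
  · rintro (⟨rfl, -⟩ | ⟨rfl, -⟩ | ⟨rfl, -⟩ | ⟨rfl, -⟩) <;> simp

/-- **Pair removal**: `c_n(x + e_a + e_b) ≤ c_n(x)` for `a ≠ b` with `x_a = x_b = 0`.
[folklore] -/
theorem count_add_single_add_single_le {a b : Fin d} (hab : a ≠ b) (n : ℕ) :
    ∀ x : Site d, x a = 0 → x b = 0 →
      SRW.count d n (x + Pi.single a 1 + Pi.single b 1) ≤ SRW.count d n x := by
  induction n with
  | zero =>
    intro x _ hb
    rw [SRW.count_zero, SRW.count_zero]
    split_ifs with h1 h2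
    · exact le_rfl
    · exfalso
      have := congrFun h1 b
      simp [Pi.single_eq_of_ne (Ne.symm hab), hb] at this
    · exact Nat.zero_le _
    · exact le_rfl
  | succ n ih =>
    intro x ha hb
    rw [show n + 1 = 1 + n from Nat.add_comm n 1, SRW.count_one_add, SRW.count_one_add]
    -- split both sums into the directions in coordinates `a, b` and the others
    rw [← Finset.sum_filter_add_sum_filter_not Finset.univ (fun v : Dir d => v.1 = a ∨ v.1 = b),
      ← Finset.sum_filter_add_sum_filter_not Finset.univ (fun v : Dir d => v.1 = a ∨ v.1 = b)
        (fun v => SRW.count d n (x - stepVec v))]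
    refine add_le_add ?_ ?_
    · -- the four special directions
      rw [filter_fst_eq_or a b hab]
      have hab' : ((a, true) : Dir d) ∉ ({(a, false), (b, true), (b, false)} : Finset (Dir d)) := by
        simp [hab]
      have hab'' : ((a, false) : Dir d) ∉ ({(b, true), (b, false)} : Finset (Dir d)) := by
        simp [hab]
      have hbb : ((b, true) : Dir d) ∉ ({(b, false)} : Finset (Dir d)) := by simp
      rw [Finset.sum_insert hab', Finset.sum_insert hab'', Finset.sum_insert hbb, Finset.sum_singleton,
        Finset.sum_insert hab', Finset.sum_insert hab'', Finset.sum_insert hbb, Finset.sum_singleton]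
      simp only [stepVec_eq_single, ↓reduceIte, Bool.false_eq_true]
      -- rewrite the eight points
      have e1 : x + Pi.single a 1 + Pi.single b 1 - Pi.single a (1 : ℤ) = x + Pi.single b 1 := by abel
      have e2 : x + Pi.single a 1 + Pi.single b 1 - Pi.single a (-1 : ℤ) =
          (x + Pi.single b 1) + Pi.single a 2 := by
        rw [show (2 : ℤ) = 1 - (-1) by norm_num, Pi.single_sub]; abel
      have e3 : x + Pi.single a 1 + Pi.single b 1 - Pi.single b (1 : ℤ) = x + Pi.single a 1 := by abel
      have e4 : x + Pi.single a 1 + Pi.single b 1 - Pi.single b (-1 : ℤ) =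
          (x + Pi.single a 1) + Pi.single b 2 := by
        rw [show (2 : ℤ) = 1 - (-1) by norm_num, Pi.single_sub]; abel
      rw [e1, e2, e3, e4]
      -- reflections on the right-hand side: `c_n(x - e_a) = c_n(x + e_a)`, etc.
      have r1 : SRW.count d n (x - Pi.single a (1 : ℤ)) = SRW.count d n (x + Pi.single a 1) :=
        (count_add_eq_count_sub_of_apply_eq_zero ha n 1).symm
      have r2 : SRW.count d n (x - Pi.single a (-1 : ℤ)) = SRW.count d n (x + Pi.single a 1) := by
        rw [Pi.single_neg, sub_neg_eq_add]
      have r3 : SRW.count d n (x - Pi.single b (1 : ℤ)) = SRW.count d n (x + Pi.single b 1) :=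
        (count_add_eq_count_sub_of_apply_eq_zero hb n 1).symm
      have r4 : SRW.count d n (x - Pi.single b (-1 : ℤ)) = SRW.count d n (x + Pi.single b 1) := by
        rw [Pi.single_neg, sub_neg_eq_add]
      rw [r1, r2, r3, r4]
      -- unimodality in `a` at `x + e_b` and in `b` at `x + e_a`
      have u1 : SRW.count d n (x + Pi.single b 1 + Pi.single a 2) ≤ SRW.count d n (x + Pi.single b 1) :=
        count_add_two_single_le a n _ (by simp [Pi.single_eq_of_ne hab, ha])
      have u2 : SRW.count d n (x + Pi.single a 1 + Pi.single b 2) ≤ SRW.count d n (x + Pi.single a 1) :=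
        count_add_two_single_le b n _ (by simp [Pi.single_eq_of_ne (Ne.symm hab), hb])
      omega
    · -- the other directions: induction hypothesis
      refine Finset.sum_le_sum fun v hv => ?_
      rw [Finset.mem_filter] at hv
      have hva : v.1 ≠ a := fun h => hv.2 (Or.inl h)
      have hvb : v.1 ≠ b := fun h => hv.2 (Or.inr h)
      have h1 : x + Pi.single a 1 + Pi.single b 1 - stepVec v =
          (x - stepVec v) + Pi.single a 1 + Pi.single b 1 := by abel
      rw [h1]
      refine ih _ ?_ ?_
      · rw [stepVec_eq_single]; simp [Pi.single_eq_of_ne (Ne.symm hva), ha]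
      · rw [stepVec_eq_single]; simp [Pi.single_eq_of_ne (Ne.symm hvb), hb]

/-! ### Reflecting a set of coordinates; reduction to `{0,1}`-vectors -/

/-- Reflect all coordinates in `S`. [folklore] -/
def reflectSet (S : Finset (Fin d)) (x : Site d) : Site d :=
  fun j => if j ∈ S then -x j else x j

/-- `c_n` is invariant under reflecting any set of coordinates. [folklore] -/
theorem count_reflectSet (n : ℕ) (S : Finset (Fin d)) (x : Site d) :
    SRW.count d n (reflectSet S x) = SRW.count d n x := by
  classical
  induction S using Finset.induction_on generalizing x with
  | empty => congr 1
  | insert i S hi ih =>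
    have : reflectSet (insert i S) x = reflectCoord i (reflectSet S x) := by
      funext j
      by_cases hj : j = i
      · subst hj; simp [reflectSet, reflectCoord, hi]
      · simp [reflectSet, reflectCoord, hj]
    rw [this, count_reflectCoord, ih]

/-- `c_n(x) = c_n(|x|)` (coordinatewise absolute values). [folklore] -/
theorem count_abs (n : ℕ) (x : Site d) : SRW.count d n (fun j => |x j|) = SRW.count d n x := by
  classical
  have : (fun j => |x j|) = reflectSet (Finset.univ.filter fun j => x j < 0) x := by
    funext j
    simp only [reflectSet, Finset.mem_filter, Finset.mem_univ, true_and]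
    split_ifs with h
    · exact abs_of_neg h
    · exact abs_of_nonneg (not_lt.1 h)
  rw [this, count_reflectSet]

/-- Parity: a walk of `n` steps ends at a site with `Σⱼ xⱼ ≡ n (mod 2)`. [folklore] -/
theorem sum_endpoint_cast_eq {n : ℕ} (σ : StepSeq d n) :
    ((∑ j, endpoint σ j : ℤ) : ZMod 2) = (n : ZMod 2) := by
  have h1 : (∑ j, endpoint σ j : ℤ) = ∑ t : Fin n, ∑ j, stepVec (σ t) j := by
    simp only [endpoint, Finset.sum_apply]
    exact Finset.sum_comm
  have h2 : ∀ t : Fin n, ((∑ j, stepVec (σ t) j : ℤ) : ZMod 2) = 1 := by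
    intro t
    rw [sum_stepVec_apply]
    split_ifs
    · simp
    · push_cast; decide
  rw [h1, Int.cast_sum]
  simp_rw [h2]
  simp

/-- If `c_n(x) ≠ 0` then `Σⱼ xⱼ ≡ n (mod 2)`. [folklore] -/
theorem sum_cast_eq_of_count_ne_zero {n : ℕ} {x : Site d} (h : SRW.count d n x ≠ 0) :
    ((∑ j, x j : ℤ) : ZMod 2) = (n : ZMod 2) := by
  classical
  rw [SRW.count, Finset.card_ne_zero] at h
  obtain ⟨σ, hσ⟩ := h
  rw [Finset.mem_filter] at hσ
  rw [← hσ.2]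
  exact sum_endpoint_cast_eq σ

/-- Permutation symmetry of `c_n` along a relabelling by an equivalence of coordinates.
[folklore] -/
theorem count_relabel_equiv (e : Fin d ≃ Fin d) (n : ℕ) (x : Site d) :
    SRW.count d n (linEmbed e.toEmbedding x) = SRW.count d n x := by
  classical
  -- `relabel e` is a bijection of `StepSeq d n` carrying `{endpoint = x}` onto `{endpoint = linEmbed e x}`
  have key : ∀ (e : Fin d ≃ Fin d) (x : Site d),
      SRW.count d n x ≤ SRW.count d n (linEmbed e.toEmbedding x) := by
    intro e x
    unfold SRW.count
    refine Finset.card_le_card_of_injOn (relabel e.toEmbedding) (fun σ hσ => ?_)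
      fun σ _ σ' _ h => relabel_injective e.toEmbedding n h
    rw [Finset.mem_coe, Finset.mem_filter] at hσ ⊢
    refine ⟨Finset.mem_univ _, ?_⟩
    rw [← pos_eq_endpoint, pos_relabel, pos_eq_endpoint, hσ.2]
  refine le_antisymm ?_ (key e x)
  have h := key e.symm (linEmbed e.toEmbedding x)
  have hid : linEmbed e.symm.toEmbedding (linEmbed e.toEmbedding x) = x := by
    funext j
    have h1 := linEmbed_apply_self e.symm.toEmbedding (linEmbed e.toEmbedding x) (e j)
    have h2 := linEmbed_apply_self e.toEmbedding x j
    simp only [Equiv.toEmbedding_apply, Equiv.symm_apply_apply] at h1 h2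
    rw [h1, h2]
  rwa [hid] at h

/-- All unit vectors have the same `c_n`: `c_n(e_a) = c_n(e_b)`. [folklore] -/
theorem count_single_eq_count_single (n : ℕ) (a b : Fin d) :
    SRW.count d n (Pi.single a 1) = SRW.count d n (Pi.single b 1) := by
  have h := count_relabel_equiv (Equiv.swap a b) n (Pi.single a 1)
  rw [show linEmbed (Equiv.swap a b).toEmbedding (Pi.single a 1) = Pi.single b 1 by
    rw [linEmbed_single]; simp] at h
  exact h.symm

/-- `c_n(-e_a) = c_n(e_a)`. [folklore] -/
theorem count_neg_single (n : ℕ) (a : Fin d) :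
    SRW.count d n (-Pi.single a 1) = SRW.count d n (Pi.single a 1) :=
  SRW.count_neg _

/-- **`2d · c_n(e_a) = c_{n+1}(0)`** (a closed walk of length `n + 1` is a walk to a neighbour of
the origin plus the step back; all `2d` neighbours have the same count). Graham:
"`c^{(0)}_{2m-1}(e₁) = c^{(0)}_{2m}(0)/(2d)`". [cite: Graham2010, Section 5, proof of Lemma 7] -/
theorem two_mul_card_mul_count_single (n : ℕ) (a : Fin d) :
    2 * d * SRW.count d n (Pi.single a 1) = SRW.count d (n + 1) 0 := by
  rw [show n + 1 = 1 + n from Nat.add_comm n 1, SRW.count_one_add]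
  have : ∀ v : Dir d, SRW.count d n (0 - stepVec v) = SRW.count d n (Pi.single a 1) := by
    intro v
    rw [zero_sub, SRW.count_neg, stepVec_eq_single]
    cases v.2
    · simp only [Bool.false_eq_true, ↓reduceIte, Pi.single_neg]
      rw [SRW.count_neg, count_single_eq_count_single n v.1 a]
    · simp only [↓reduceIte]
      exact count_single_eq_count_single n v.1 a
  rw [Finset.sum_congr rfl fun v _ => this v, Finset.sum_const, Finset.card_univ, card_dir, smul_eq_mul]

/-- **The maximum principle at odd times** (Graham: "When `k` is odd, `c_k^{(0)}(x)` is maximized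
by `x = e₁`"): for odd `n`, `c_n(x) ≤ c_n(e_a)` for every `x` and every coordinate `a`.
Proof: reflect to `x ≥ 0` (`count_abs`), reduce the coordinates modulo `2` by unimodality
(`count_add_two_single_le`), remove pairs of unit coordinates (`count_add_single_add_single_le`)
— an odd number of them is present by parity — and move the last one to `a` by symmetry.
[cite: Graham2010, Section 5, proof of Lemma 7] -/
theorem count_le_count_single {n : ℕ} (hn : Odd n) (a : Fin d) (x : Site d) :
    SRW.count d n x ≤ SRW.count d n (Pi.single a 1) := by
  classical
  -- induction on `Φ(x) = Σ |x_j|`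
  suffices H : ∀ (N : ℕ) (x : Site d), (∑ j, (x j).natAbs) ≤ N → (∀ j, 0 ≤ x j) →
      SRW.count d n x ≤ SRW.count d n (Pi.single a 1) by
    rw [← count_abs]
    exact H _ _ le_rfl fun j => abs_nonneg _
  intro N
  induction N with
  | zero =>
    intro x hx hpos
    -- `x = 0`, `n` odd: `c_n(0) = 0`
    have hx0 : x = 0 := by
      funext j
      have := Finset.sum_eq_zero_iff.1 (Nat.le_zero.1 hx) j (Finset.mem_univ j)
      simpa using this
    subst hx0
    by_cases h : SRW.count d n 0 = 0
    · rw [h]; exact Nat.zero_le _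
    · exfalso
      have hpar := sum_cast_eq_of_count_ne_zero h
      simp only [Pi.zero_apply, Finset.sum_const_zero, Int.cast_zero] at hpar
      have : (n : ZMod 2) = 1 := (ZMod.natCast_eq_one_iff_odd).2 hn
      rw [this] at hpar
      exact zero_ne_one hpar
  | succ N ih =>
    intro x hx hpos
    by_cases hbig : ∃ j, 2 ≤ x j
    · -- reduce coordinate `j` by `2`
      obtain ⟨j, hj⟩ := hbig
      set x' : Site d := x - Pi.single j 2 with hx'
      have hxx' : x = x' + Pi.single j 2 := by rw [hx']; abel
      have hx'j : 0 ≤ x' j := by simp [hx']; omega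
      have hle : SRW.count d n x ≤ SRW.count d n x' := by
        rw [hxx']; exact count_add_two_single_le j n x' hx'j
      refine hle.trans (ih x' ?_ ?_)
      · -- `Φ(x') = Φ(x) - 2 ≤ N`
        have hsum : (∑ i, (x i).natAbs) = (∑ i, (x' i).natAbs) + 2 := by
          rw [← Finset.sum_erase_add _ _ (Finset.mem_univ j), ← Finset.sum_erase_add _ _ (Finset.mem_univ j)]
          have h1 : ∀ i ∈ Finset.univ.erase j, (x i).natAbs = (x' i).natAbs := by
            intro i hi
            rw [Finset.mem_erase] at hi
            simp [hx', Pi.single_eq_of_ne hi.1]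
          rw [Finset.sum_congr rfl h1]
          have h2 : (x j).natAbs = (x' j).natAbs + 2 := by
            simp only [hx', Pi.sub_apply, Pi.single_eq_same]
            omega
          rw [h2]; ring
        omega
      · intro i
        by_cases hi : i = j
        · subst hi; exact hx'j
        · simp [hx', Pi.single_eq_of_ne hi, hpos i]
    · -- all coordinates are `0` or `1`
      have h01 : ∀ j, x j = 0 ∨ x j = 1 := by
        intro j
        have := hpos j
        have : ¬ (2 ≤ x j) := fun h => hbig ⟨j, h⟩
        omega
      by_cases hzero : SRW.count d n x = 0
      · rw [hzero]; exact Nat.zero_le _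
      -- the set `J` of unit coordinates has odd cardinality
      set J : Finset (Fin d) := Finset.univ.filter fun j => x j = 1 with hJ
      have hxJ : x = fun j => if j ∈ J then 1 else 0 := by
        funext j
        rcases h01 j with h | h
        · simp [hJ, h]
        · simp [hJ, h]
      have hsumJ : (∑ j, x j : ℤ) = J.card := by
        conv_lhs => rw [hxJ]
        simp [hJ]
      have hJodd : Odd J.card := by
        have hpar := sum_cast_eq_of_count_ne_zero hzero
        rw [hsumJ, Int.cast_natCast, (ZMod.natCast_eq_one_iff_odd).2 hn] at hpar
        exact (ZMod.natCast_eq_one_iff_odd).1 hpar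
      -- pick `b ∈ J`
      have hJne : J.Nonempty := by
        rw [← Finset.card_pos]; exact hJodd.pos
      obtain ⟨b, hb⟩ := hJne
      by_cases hJ1 : J.card = 1
      · -- `x = e_b`
        obtain ⟨b', hb'⟩ := Finset.card_eq_one.1 hJ1
        have hxb : x = Pi.single b' 1 := by
          rw [hxJ, hb']
          funext j
          by_cases hj : j = b' <;> simp [hj]
        rw [hxb, count_single_eq_count_single n b' a]
      · -- `|J| ≥ 3`: remove two unit coordinates `b ≠ c`
        have hJ3 : 3 ≤ J.card := by
          obtain ⟨k, hk⟩ := hJodd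
          omega
        obtain ⟨c, hc, hcb⟩ : ∃ c ∈ J, c ≠ b := by
          have : 1 < J.card := by omega
          obtain ⟨c, hc, hne⟩ := Finset.exists_mem_ne this b
          exact ⟨c, hc, hne⟩
        set x'' : Site d := x - Pi.single b 1 - Pi.single c 1 with hx''
        have hxx'' : x = x'' + Pi.single b 1 + Pi.single c 1 := by rw [hx'']; abel
        have hb1 : x b = 1 := (Finset.mem_filter.1 hb).2
        have hc1 : x c = 1 := (Finset.mem_filter.1 hc).2
        have hx''b : x'' b = 0 := by simp [hx'', Pi.single_eq_of_ne hcb.symm, hb1]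
        have hx''c : x'' c = 0 := by simp [hx'', Pi.single_eq_of_ne hcb, hc1]
        have hle : SRW.count d n x ≤ SRW.count d n x'' := by
          rw [hxx'']; exact count_add_single_add_single_le hcb.symm n x'' hx''b hx''c
        refine hle.trans (ih x'' ?_ ?_)
        · have hsum : (∑ i, (x i).natAbs) = (∑ i, (x'' i).natAbs) + 2 := by
            have hsplit : ∀ y : Site d, (∑ i, (y i).natAbs) =
                (∑ i ∈ (Finset.univ.erase b).erase c, (y i).natAbs) + (y c).natAbs + (y b).natAbs := by
              intro y
              rw [← Finset.sum_erase_add _ _ (Finset.mem_univ b),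
                ← Finset.sum_erase_add _ _ (Finset.mem_erase.2 ⟨hcb, Finset.mem_univ c⟩)]
            rw [hsplit x, hsplit x'']
            have h1 : ∀ i ∈ (Finset.univ.erase b).erase c, (x i).natAbs = (x'' i).natAbs := by
              intro i hi
              simp only [Finset.mem_erase] at hi
              simp [hx'', Pi.single_eq_of_ne hi.1, Pi.single_eq_of_ne hi.2.1]
            rw [Finset.sum_congr rfl h1, hx''b, hx''c, hb1, hc1]
            simp
          omega
        · intro i
          by_cases hib : i = b
          · subst hib; rw [hx''b]
          · by_cases hic : i = c
            · subst hic; rw [hx''c]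
            · simp [hx'', Pi.single_eq_of_ne hib, Pi.single_eq_of_ne hic, hpos i]

/-- The form used in Lemma 7: **`2d · c_{2m-1}(x) ≤ c_{2m}(0)`** for all `x` (`m ≥ 1`).
[cite: Graham2010, Section 5, proof of Lemma 7] -/
theorem two_mul_card_mul_count_odd_le {m : ℕ} (hm : 1 ≤ m) (x : Site d) :
    2 * d * SRW.count d (2 * m - 1) x ≤ SRW.count d (2 * m) 0 := by
  rcases Nat.eq_zero_or_pos d with hd | hd
  · subst hd; simp
  · have a : Fin d := ⟨0, hd⟩
    have hodd : Odd (2 * m - 1) := ⟨m - 1, by omega⟩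
    calc 2 * d * SRW.count d (2 * m - 1) x ≤ 2 * d * SRW.count d (2 * m - 1) (Pi.single a 1) :=
          Nat.mul_le_mul_left _ (count_le_count_single hodd a x)
      _ = SRW.count d (2 * m - 1 + 1) 0 := two_mul_card_mul_count_single _ a
      _ = SRW.count d (2 * m) 0 := by rw [show 2 * m - 1 + 1 = 2 * m by omega]

/-! ### The factorial bound on the return counts -/

/-- `m! ≤ D! · d^{m-D}` for `D ≤ m ≤ d`. [folklore] -/
theorem factorial_le_factorial_mul_pow {D m d : ℕ} (hDm : D ≤ m) (hmd : m ≤ d) :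
    m.factorial ≤ D.factorial * d ^ (m - D) := by
  induction m with
  | zero =>
    have : D = 0 := by omega
    subst this; simp
  | succ m ih =>
    rcases Nat.eq_or_lt_of_le hDm with rfl | hlt
    · simp
    · have h := ih (by omega) (by omega)
      rw [Nat.factorial_succ, show m + 1 - D = (m - D) + 1 by omega, pow_succ]
      calc (m + 1) * m.factorial ≤ d * (D.factorial * d ^ (m - D)) :=
            Nat.mul_le_mul (by omega) h
        _ = D.factorial * (d ^ (m - D) * d) := by ring

/-- The dimension-`D` part of the return count vanishes for `D > m`: a closed walk of length `2m`
uses each of its coordinates at least twice. [folklore] -/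
theorem dimCount_endpoint_eq_zero_of_lt {m D : ℕ} (h : m < D) :
    dimCount (2 * m) (fun D (σ : StepSeq D (2 * m)) => endpoint σ = 0) D = 0 := by
  classical
  unfold dimCount
  rw [Finset.card_eq_zero, Finset.filter_eq_empty_iff]
  rintro σ - ⟨hend, hused⟩
  have hpos : pos σ 0 = pos σ (2 * m) := by rw [pos_zero, pos_eq_endpoint, hend]
  have htwo : ∀ j : Fin D, 2 ≤ (Finset.univ.filter fun i : Fin (2 * m) => (σ i).1 = j).card := by
    intro j
    have hj : j ∈ usedDirs σ := by rw [hused]; exact Finset.mem_univ j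
    obtain ⟨i, hi⟩ := (mem_usedDirs σ j).1 hj
    obtain ⟨i', hne, -, -, hi'⟩ := exists_other_step_of_pos_eq σ (Nat.zero_le _) hpos i
      (Nat.zero_le _) i.isLt
    rw [hi] at hi'
    have hsub : ({i, i'} : Finset (Fin (2 * m))) ⊆ Finset.univ.filter fun i : Fin (2 * m) => (σ i).1 = j := by
      intro y hy
      rw [Finset.mem_insert, Finset.mem_singleton] at hy
      rw [Finset.mem_filter]
      rcases hy with rfl | rfl
      · exact ⟨Finset.mem_univ _, hi⟩
      · exact ⟨Finset.mem_univ _, hi'⟩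
    calc 2 = ({i, i'} : Finset (Fin (2 * m))).card := by rw [Finset.card_pair hne.symm]
      _ ≤ _ := Finset.card_le_card hsub
  have hsum : (Finset.univ : Finset (Fin (2 * m))).card =
      ∑ j : Fin D, (Finset.univ.filter fun i : Fin (2 * m) => (σ i).1 = j).card :=
    Finset.card_eq_sum_card_fiberwise fun i _ => Finset.mem_univ _
  have : 2 * D ≤ 2 * m := by
    calc 2 * D = ∑ _j : Fin D, 2 := by simp [mul_comm]
      _ ≤ ∑ j : Fin D, (Finset.univ.filter fun i : Fin (2 * m) => (σ i).1 = j).card :=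
          Finset.sum_le_sum fun j _ => htwo j
      _ = 2 * m := by rw [← hsum, Finset.card_univ, Fintype.card_fin]
  omega

/-- **Hammersley's bound in Graham's form**: `c_{2m}(0) ≤ (m+1)·36^m·m!·d^m` for `1 ≤ m ≤ d`
("`c^{(0)}_{2m}(0) ≤ C(d,m)(2m)^{2m} ≤ (d^m/m!)(2m)^{2m}` … `(2m)c^{(0)}_{2m}(0) ≤ C₄^m s^{-m} m!`").
[cite: Graham2010, Section 5, proof of Lemma 7] -/
theorem count_two_mul_zero_le {m : ℕ} (hm : 1 ≤ m) (hmd : m ≤ d) :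
    (SRW.count d (2 * m) 0 : ℝ) ≤ ((m : ℝ) + 1) * (36 : ℝ) ^ m * (m.factorial : ℝ) * (d : ℝ) ^ m := by
  classical
  -- dimension decomposition of the closed walks
  have hdec := card_filter_eq_sum_choose_mul (n := 2 * m)
    (fun D (σ : StepSeq D (2 * m)) => endpoint σ = 0) (fun D d ι σ => by
      rw [← pos_eq_endpoint, pos_relabel, pos_eq_endpoint]
      exact ⟨fun h => linEmbed_injective ι (by rw [h, map_zero]), fun h => by rw [h, map_zero]⟩) d
  have hcount : SRW.count d (2 * m) 0 =
      ∑ D ∈ Finset.range (2 * m + 1), d.choose D * dimCount (2 * m) (fun D (σ : StepSeq D (2 * m)) => endpoint σ = 0) D := by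
    rw [← hdec]; rfl
  -- only `1 ≤ D ≤ m` contribute, each at most `C(d,D)(2D)^{2m} ≤ (d^m/m!)(2m)^{2m}`
  have hterm : ∀ D ∈ Finset.range (2 * m + 1),
      ((d.choose D * dimCount (2 * m) (fun D (σ : StepSeq D (2 * m)) => endpoint σ = 0) D : ℕ) : ℝ) ≤
        if D ∈ Finset.Icc 1 m then (d : ℝ) ^ m / (m.factorial : ℝ) * (2 * (m : ℝ)) ^ (2 * m) else 0 := by
    intro D _
    split_ifs with hD
    · rw [Finset.mem_Icc] at hD
      have hle : dimCount (2 * m) (fun D (σ : StepSeq D (2 * m)) => endpoint σ = 0) D ≤ (2 * D) ^ (2 * m) := by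
        unfold dimCount
        exact (Finset.card_filter_le _ _).trans (by rw [Finset.card_univ, card_stepSeq])
      have hchoose : (d.choose D : ℝ) ≤ (d : ℝ) ^ D / (D.factorial : ℝ) := Nat.choose_le_pow_div D d
      have hfac : (d : ℝ) ^ D / (D.factorial : ℝ) ≤ (d : ℝ) ^ m / (m.factorial : ℝ) := by
        rw [div_le_div_iff₀ (by positivity) (by positivity)]
        have h := factorial_le_factorial_mul_pow hD.2 hmd
        have h' : (m.factorial : ℝ) ≤ (D.factorial : ℝ) * (d : ℝ) ^ (m - D) := by exact_mod_cast h
        calc (d : ℝ) ^ D * (m.factorial : ℝ) ≤ (d : ℝ) ^ D * ((D.factorial : ℝ) * (d : ℝ) ^ (m - D)) := by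
              gcongr
          _ = (d : ℝ) ^ m * (D.factorial : ℝ) := by
              rw [mul_comm ((D.factorial : ℝ)), ← mul_assoc, ← pow_add, Nat.add_sub_cancel' hD.2]
      have hpow : ((2 * D) ^ (2 * m) : ℝ) ≤ (2 * (m : ℝ)) ^ (2 * m) := by
        have : (2 * (D : ℝ)) ≤ 2 * (m : ℝ) := by exact_mod_cast Nat.mul_le_mul_left 2 hD.2
        exact pow_le_pow_left₀ (by positivity) this _
      push_cast
      calc (d.choose D : ℝ) * (dimCount (2 * m) (fun D (σ : StepSeq D (2 * m)) => endpoint σ = 0) D : ℝ)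
          ≤ ((d : ℝ) ^ D / (D.factorial : ℝ)) * ((2 * D) ^ (2 * m) : ℝ) := by
            refine mul_le_mul hchoose (by exact_mod_cast hle) (by positivity) (by positivity)
        _ ≤ (d : ℝ) ^ m / (m.factorial : ℝ) * (2 * (m : ℝ)) ^ (2 * m) :=
            mul_le_mul hfac hpow (by positivity) (by positivity)
    · -- `D = 0` or `D > m`: the term vanishes
      rw [Finset.mem_Icc, not_and_or, not_le, not_le] at hD
      rcases hD with h0 | hbig
      · have : D = 0 := by omega
        subst this
        have : dimCount (2 * m) (fun D (σ : StepSeq D (2 * m)) => endpoint σ = 0) 0 = 0 := by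
          unfold dimCount
          rw [Finset.card_eq_zero, Finset.filter_eq_empty_iff]
          rintro σ - -
          have i : Fin (2 * m) := ⟨0, by omega⟩
          exact Fin.elim0 (σ i).1
        rw [this]; simp
      · rw [dimCount_endpoint_eq_zero_of_lt hbig]; simp
  calc (SRW.count d (2 * m) 0 : ℝ)
      = ∑ D ∈ Finset.range (2 * m + 1),
          ((d.choose D * dimCount (2 * m) (fun D (σ : StepSeq D (2 * m)) => endpoint σ = 0) D : ℕ) : ℝ) := by
        rw [hcount]; push_cast; rfl
    _ ≤ ∑ D ∈ Finset.range (2 * m + 1),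
          (if D ∈ Finset.Icc 1 m then (d : ℝ) ^ m / (m.factorial : ℝ) * (2 * (m : ℝ)) ^ (2 * m) else 0) :=
        Finset.sum_le_sum hterm
    _ = (m : ℝ) * ((d : ℝ) ^ m / (m.factorial : ℝ) * (2 * (m : ℝ)) ^ (2 * m)) := by
        rw [Finset.sum_ite, Finset.sum_const_zero, add_zero, Finset.sum_const, nsmul_eq_mul]
        congr 1
        rw [Finset.filter_mem_eq_inter, Finset.inter_eq_right.2 (fun D hD => by
          rw [Finset.mem_Icc] at hD; rw [Finset.mem_range]; omega), Nat.card_Icc]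
        push_cast
        ring
    _ ≤ ((m : ℝ) + 1) * (36 : ℝ) ^ m * (m.factorial : ℝ) * (d : ℝ) ^ m := by
        -- `(2m)^{2m}/m! = 4^m m^m (m^m/m!) ≤ 4^m (3^m m!) 3^m = 36^m m!`
        have hmm : ((m : ℝ)) ^ m ≤ (3 : ℝ) ^ m * (m.factorial : ℝ) := pow_self_le_three_pow_mul_factorial m
        have hfpos : (0 : ℝ) < (m.factorial : ℝ) := by positivity
        have hkey : (2 * (m : ℝ)) ^ (2 * m) / (m.factorial : ℝ) ≤ (36 : ℝ) ^ m * (m.factorial : ℝ) := by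
          rw [div_le_iff₀ hfpos]
          calc (2 * (m : ℝ)) ^ (2 * m) = (4 : ℝ) ^ m * ((m : ℝ) ^ m * (m : ℝ) ^ m) := by
                rw [pow_mul, mul_pow]; norm_num; ring
            _ ≤ (4 : ℝ) ^ m * (((3 : ℝ) ^ m * (m.factorial : ℝ)) * ((3 : ℝ) ^ m * (m.factorial : ℝ))) := by
                gcongr
            _ = (36 : ℝ) ^ m * (m.factorial : ℝ) * (m.factorial : ℝ) := by
                rw [show (36 : ℝ) = 4 * (3 * 3) by norm_num, mul_pow, mul_pow]; ring
        calc (m : ℝ) * ((d : ℝ) ^ m / (m.factorial : ℝ) * (2 * (m : ℝ)) ^ (2 * m))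
            = (m : ℝ) * (d : ℝ) ^ m * ((2 * (m : ℝ)) ^ (2 * m) / (m.factorial : ℝ)) := by ring
          _ ≤ ((m : ℝ) + 1) * (d : ℝ) ^ m * ((36 : ℝ) ^ m * (m.factorial : ℝ)) := by
              gcongr
              linarith
          _ = ((m : ℝ) + 1) * (36 : ℝ) ^ m * (m.factorial : ℝ) * (d : ℝ) ^ m := by ring

end Literature.Probability.RandomPlanarGeometry.SAW.Zd.Graham2010
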